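import Literature.NumberTheory.LFunctions.HalaszRestrictedMeanSquare
import HarnessLib

/-!
# Halász's theorem for block-restricted sums over multiplicative windows, I: the mean square

First file of a SHORT-INTERVAL version of Halász's theorem for block-restricted sums
(`Halasz.Restricted.norm_restr_sum_le`, tree): for `a = g̃ 1_𝒮` we want to bound the sums of `a` over
multiplicative windows `(x, νx]`, `1 < ν ≤ 2`, by `(ν - 1) x ((1 + M_½) e^{-M_½} + …)` rather than by
differencing two long sums (which loses the factor `ν - 1`).  The Granville–Soundararajan method of the tree
files `HalaszRestrictedMeanSquare.lean` / `HalaszRestricted.lean` runs for window sums once the mean square of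
`A(νe^u) - A(e^u)` (`A(y) = ∑_{n ≤ y} a(n) log n`) is controlled with the gain `(ν - 1)²` on its `1/α`-term.
Everything here is PROVED; no definitions of mathematical content beyond bookkeeping abbreviations, no named
facts.

* `MellinPlancherel.integral_norm_sq_psum_interval_exp` — **Mellin–Plancherel for multiplicative windows**:
  for `ℓ¹`-weighted coefficients with partial sums of polynomial growth and any `ν > 0`,
  `∫ |A(νe^u) - A(e^u)|² e^{-2σu} du = (1/2π) ∫ |L(σ+iy)|² |ν^{σ+iy} - 1|²/|σ+iy|² dy` (the window function
  `φ_ν = e^{σ log ν} φ(· + log ν) - φ` has transform `(ν^s - 1) L(s)/s`; Plancherel from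
  `Literature.Analysis.FunctionSpaces.integral_norm_sq_fourierIntegral_eq`);
* `Halasz.wI` — the weight `w_ν(α,y) = |ν^{1+α+iy} - 1|²/|1+α+iy|²`, `≤ 25/|s|²` for `ν ≤ 2`, `α ≤ 1`;
* `Halasz.norm_psum_sub_le_psi_sub`, `Halasz.psi_sub_psi_le`, `Halasz.theta_sub_theta_le`,
  `Halasz.theta_increment_le` — increments of `Λ`-dominated sums over `(y, νy]`:
  `≤ ψ(νy) - ψ(y) ≤ (θ(νy) - θ(y)) + 2√(νy) log(νy)`, with `θ(νy) - θ(y) ≤ (log 4)νy` always and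
  `≤ 2(ν-1)y` for `log y ≥ u₁ = 1 + (3C/(ν-1))^{1/6}` by the prime number theorem with error `x/(log x)^6`
  (`ChebyshevThetaDeLaValleePoussin_holds.logPow 6`, tree; `C` is kept as a parameter);
* `Halasz.intervalMeanSquare_le`, `Halasz.intervalMeanSquare_le_of_vanish` — for `|b_n| ≤ Λ(n)`,
  `∫ |B(νe^u) - B(e^u)|² e^{-2(1+α)u} du ≤ 4(ν-1)²/α + 16u₁ + 256`, and `≤ 8(ν-1)² log Q + 16u₁ + 256` if
  `b` vanishes at the primes `> Q` (block pieces): an explicit integrable majorant in three pieces;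
* `Halasz.Restricted.meanSquare_mulLog_restr_interval_le` — **GS03 Lemma 3.2 for the restricted function over
  windows**: with `‖𝒢_a‖ ≤ B` on `|y| ≤ T₀` and `‖𝒢_{a_i}‖ ≤ B_c`,
  `∫ |A(νe^u) - A(e^u)|² e^{-2(1+α)u} du ≤ 2B²(4(ν-1)²/α + 16u₁ + 256) + 2B_c²|𝓙|²(8(ν-1)² log Q + 16u₁ + 256)
   + (25/π)(240/T₀ + (1920 + 520e^{10}/α³)/T₀²)`
  (factorisation `D_a = P_∁ 𝒢_a + ∑ P_i 𝒢_{a_i}` and dyadic tails of `HalaszRestrictedMeanSquare.lean`; the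
  `P`-integrals against `w_ν` are, by Mellin–Plancherel again, the interval mean squares above).

Purpose: the window `|t - t₁| ≤ (log X)^{1/16}` of Matomäki–Radziwiłł–Tao 2015, Proposition A.3 for the
restricted polynomial in `L²` (via Gallagher's lemma the `L²`-norm near the minimising twist is controlled by
sums of `f n^{-it₁} 1_𝒮` over windows `(y, (1 + 1/L) y]`), towards Theorem 1.7 of that paper with the printed
rate `e^{-M/20}` (`MRT2015.theorem17_of_propA3With_sq`, `MatomakiRadziwillTaoTheorem17OfA2WithSq.lean`).

## References
* A. Granville, K. Soundararajan, *Decay of mean values of multiplicative functions*, Canad. J. Math. 55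
  (2003), §3b, Lemma 3.2 (the method). [cite: GranvilleSoundararajan2003, Lemma 3.2]
* H. L. Montgomery, R. C. Vaughan, *Multiplicative Number Theory I*, §5.1 (Plancherel for Dirichlet series),
  Theorem 6.9 (prime number theorem with error term).
* K. Matomäki, M. Radziwiłł, T. Tao, Algebra & Number Theory 9 (2015), Appendix A, Proposition A.3 (proof:
  the ranges `𝒯₀ ∪ 𝒯₁`). [cite: MatomakiRadziwillTao2015, Appendix A, Proposition A.3 (proof)]

## Design choices
* `1 < ν ≤ 2` throughout; the PNT constant `C` (`|θ(x) - x| ≤ Cx/(log x)^6`, `x ≥ 2`) is a hypothesis of the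
  lemmas, instantiated once at the end of the short-interval theorem; `u₁ = Halasz.uPNT C ν ≤ (1 + (3C)^{1/6})(ν-1)^{-1/6}`.
* Constants are explicit and crude; only the `(ν - 1)²`-gain on the `1/α`- and `log Q`-terms matters downstream.
-/

noncomputable section

open MeasureTheory Real Complex Finset Set Filter FourierTransform

namespace Literature.NumberTheory.LFunctions

namespace MellinPlancherel

variable {a : ℕ → ℂ} {σ θ C : ℝ}

/-- The interval version of `φ`: `φ_ν(u) = e^{-σu} (A(ν e^u) - A(e^u))`, the exponentially damped
sum of `a` over the multiplicative window `(e^u, ν e^u]`. [folklore] -/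
def phiI (a : ℕ → ℂ) (σ ν : ℝ) (u : ℝ) : ℂ :=
  (Real.exp (-(σ * u)) : ℂ) * (psum a (ν * Real.exp u) - psum a (Real.exp u))

/-- `φ_ν = e^{σ log ν} φ(· + log ν) - φ`. [folklore] -/
theorem phiI_eq (a : ℕ → ℂ) (σ : ℝ) {ν : ℝ} (hν : 0 < ν) (u : ℝ) :
    phiI a σ ν u = (Real.exp (σ * Real.log ν) : ℂ) * phi a σ (u + Real.log ν) - phi a σ u := by
  unfold phiI phi
  have h1 : Real.exp (u + Real.log ν) = ν * Real.exp u := by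
    rw [Real.exp_add, Real.exp_log hν]; ring
  have h2 : (Real.exp (σ * Real.log ν) : ℂ) * (Real.exp (-(σ * (u + Real.log ν))) : ℂ) =
      (Real.exp (-(σ * u)) : ℂ) := by
    rw [← Complex.ofReal_mul, ← Real.exp_add]
    congr 1; congr 1; ring
  rw [h1, ← mul_assoc, h2]
  ring

/-- `‖φ_ν(u)‖ = e^{-σu} ‖A(νe^u) - A(e^u)‖`. [folklore] -/
theorem norm_phiI (a : ℕ → ℂ) (σ ν u : ℝ) :
    ‖phiI a σ ν u‖ = Real.exp (-(σ * u)) * ‖psum a (ν * Real.exp u) - psum a (Real.exp u)‖ := by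
  unfold phiI
  rw [norm_mul, Complex.norm_real, Real.norm_of_nonneg (Real.exp_pos _).le]

/-- `φ_ν ∈ L¹(ℝ)` under the growth bound. [folklore] -/
theorem integrable_phiI (hbd : ∀ y : ℝ, 1 ≤ y → ‖psum a y‖ ≤ C * y ^ θ) (hθ : θ < σ) {ν : ℝ}
    (hν : 0 < ν) : Integrable (phiI a σ ν) := by
  have h1 := integrable_phi hbd hθ
  have h2 : Integrable (fun u => phi a σ (u + Real.log ν)) := h1.comp_add_right (Real.log ν)
  have h3 := (h2.const_mul ((Real.exp (σ * Real.log ν) : ℝ) : ℂ)).sub h1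
  refine h3.congr (Filter.Eventually.of_forall fun u => ?_)
  simp only [Pi.sub_apply]
  exact (phiI_eq a σ hν u).symm

/-- `φ_ν` is bounded: `‖φ_ν(u)‖ ≤ e^{σ log ν} C + C`. [folklore] -/
theorem norm_phiI_le_const (hbd : ∀ y : ℝ, 1 ≤ y → ‖psum a y‖ ≤ C * y ^ θ) (hθ : θ < σ) {ν : ℝ}
    (hν : 0 < ν) (u : ℝ) : ‖phiI a σ ν u‖ ≤ Real.exp (σ * Real.log ν) * C + C := by
  rw [phiI_eq a σ hν u]
  refine (norm_sub_le _ _).trans (add_le_add ?_ (norm_phi_le_const hbd hθ u))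
  rw [norm_mul, Complex.norm_real, Real.norm_of_nonneg (Real.exp_pos _).le]
  exact mul_le_mul_of_nonneg_left (norm_phi_le_const hbd hθ _) (Real.exp_pos _).le

/-- `φ_ν ∈ L²(ℝ)`. [folklore] -/
theorem memLp_two_phiI (hbd : ∀ y : ℝ, 1 ≤ y → ‖psum a y‖ ≤ C * y ^ θ) (hθ : θ < σ) {ν : ℝ}
    (hν : 0 < ν) : MemLp (phiI a σ ν) 2 :=
  Literature.NumberTheory.LFunctions.WindowPlancherel.memLp_two_of_norm_le (integrable_phiI hbd hθ hν)
    (norm_phiI_le_const hbd hθ hν)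

/-- The phase times an integrable function is integrable. [folklore] -/
theorem integrable_fourierChar_smul {f : ℝ → ℂ} (hf : Integrable f) (ξ : ℝ) :
    Integrable (fun v : ℝ => 𝐞 (-(v * ξ)) • f v) := by
  refine hf.norm.mono' ?_ (Filter.Eventually.of_forall fun v => ?_)
  · exact (Real.continuous_fourierChar.comp (by fun_prop : Continuous fun v : ℝ => -(v * ξ))).aestronglyMeasurable.smul
      hf.aestronglyMeasurable
  · rw [Circle.smul_def, norm_smul, Circle.norm_coe, one_mul]

variable (hσ : 0 < σ) (hsum : Summable fun n : ℕ => ‖a n‖ / (n : ℝ) ^ σ)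
include hσ hsum

/-- **The Fourier transform of `φ_ν`**: `𝓕φ_ν(ξ) = (ν^s - 1) L(s)/s`, `s = σ + 2πiξ` (translation
multiplies the transform by the phase `e(ξ log ν)`, and `e^{σ log ν} e(ξ log ν) = ν^s`). [folklore] -/
theorem fourier_phiI (hbd : ∀ y : ℝ, 1 ≤ y → ‖psum a y‖ ≤ C * y ^ θ) (hθ : θ < σ) {ν : ℝ} (hν : 0 < ν)
    (ξ : ℝ) :
    𝓕 (phiI a σ ν) ξ = ((ν : ℂ) ^ ((σ : ℂ) + (2 * π * ξ : ℝ) * I) - 1) *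
      (LSeries a (σ + (2 * π * ξ : ℝ) * I) / (σ + (2 * π * ξ : ℝ) * I)) := by
  set δ : ℝ := Real.log ν with hδ
  set c : ℂ := (Real.exp (σ * δ) : ℂ) with hc
  have hphi := integrable_phi hbd hθ
  have hF := fourier_phi (a := a) hσ hsum ξ
  rw [Real.fourier_real_eq] at hF ⊢
  -- split the integrand
  have hfun : (fun v : ℝ => 𝐞 (-(v * ξ)) • phiI a σ ν v) =
      fun v : ℝ => c * (𝐞 (-(v * ξ)) • phi a σ (v + δ)) - 𝐞 (-(v * ξ)) • phi a σ v := by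
    funext v
    rw [phiI_eq a σ hν v, Circle.smul_def, Circle.smul_def, Circle.smul_def, smul_eq_mul, smul_eq_mul,
      smul_eq_mul]
    ring
  have hint1 : Integrable (fun v : ℝ => 𝐞 (-(v * ξ)) • phi a σ (v + δ)) :=
    integrable_fourierChar_smul (hphi.comp_add_right δ) ξ
  have hint2 : Integrable (fun v : ℝ => 𝐞 (-(v * ξ)) • phi a σ v) :=
    integrable_fourierChar_smul hphi ξ
  rw [hfun, integral_sub (hint1.const_mul c) hint2, integral_const_mul, hF]
  -- the translated integral
  have htrans : ∫ v : ℝ, 𝐞 (-(v * ξ)) • phi a σ (v + δ) =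
      (𝐞 (δ * ξ) : ℂ) * ∫ v : ℝ, 𝐞 (-(v * ξ)) • phi a σ v := by
    have h := integral_add_right_eq_self (μ := (volume : Measure ℝ))
      (fun v : ℝ => 𝐞 (-((v - δ) * ξ)) • phi a σ v) δ
    simp only [add_sub_cancel_right] at h
    rw [h, ← integral_const_mul]
    refine integral_congr_ae (Filter.Eventually.of_forall fun v => ?_)
    simp only [Circle.smul_def, smul_eq_mul]
    rw [← mul_assoc, ← Circle.coe_mul, ← AddChar.map_add_eq_mul]
    congr 2
    ring
  rw [htrans, hF]
  -- `c · e(δ ξ) = ν^s`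
  have hcpow : c * (𝐞 (δ * ξ) : ℂ) = (ν : ℂ) ^ ((σ : ℂ) + (2 * π * ξ : ℝ) * I) := by
    rw [hc, Real.fourierChar_apply, Complex.ofReal_exp, ← Complex.exp_add,
      Complex.cpow_def_of_ne_zero (by exact_mod_cast hν.ne')]
    congr 1
    rw [show Complex.log (ν : ℂ) = (Real.log ν : ℂ) from (Complex.ofReal_log hν.le).symm, ← hδ]
    push_cast
    ring
  rw [← hcpow]
  ring

/-- **Mellin–Plancherel for multiplicative windows**: for `ℓ¹`-weighted coefficients
(`∑ |a_n| n^{-σ} < ∞`, `σ > 0`) whose partial sums satisfy `|A(y)| ≤ C y^θ` (`y ≥ 1`) for some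
`θ < σ`, and any `ν > 0`,
`∫ |A(νe^u) - A(e^u)|² e^{-2σu} du = (1/2π) ∫ |L(σ+iy)|² |ν^{σ+iy} - 1|²/|σ+iy|² dy`
(Plancherel for `φ_ν`, whose transform is `(ν^s - 1) L(s)/s`).  For `ν > 1` the left side is the
damped mean square of the sums of `a` over the windows `(y, νy]`. [folklore] -/
theorem integral_norm_sq_psum_interval_exp (hθ : θ < σ)
    (hbd : ∀ y : ℝ, 1 ≤ y → ‖psum a y‖ ≤ C * y ^ θ) {ν : ℝ} (hν : 0 < ν) :
    ∫ u : ℝ, ‖psum a (ν * Real.exp u) - psum a (Real.exp u)‖ ^ 2 * Real.exp (-(2 * σ * u)) =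
      (1 / (2 * π)) * ∫ y : ℝ, ‖LSeries a (σ + y * I)‖ ^ 2 *
        (‖(ν : ℂ) ^ ((σ : ℂ) + y * I) - 1‖ ^ 2 / ‖(σ : ℂ) + y * I‖ ^ 2) := by
  have hP := Literature.Analysis.FunctionSpaces.integral_norm_sq_fourierIntegral_eq
    (integrable_phiI hbd hθ hν) (memLp_two_phiI hbd hθ hν)
  -- right-hand side of Plancherel
  have hR : ∫ u : ℝ, ‖phiI a σ ν u‖ ^ 2 =
      ∫ u : ℝ, ‖psum a (ν * Real.exp u) - psum a (Real.exp u)‖ ^ 2 * Real.exp (-(2 * σ * u)) := by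
    refine integral_congr_ae (Filter.Eventually.of_forall fun u => ?_)
    simp only [norm_phiI]
    rw [mul_pow, ← Real.exp_nat_mul]
    ring_nf
  -- left-hand side of Plancherel
  set G : ℝ → ℝ := fun y => ‖LSeries a (σ + y * I)‖ ^ 2 *
    (‖(ν : ℂ) ^ ((σ : ℂ) + y * I) - 1‖ ^ 2 / ‖(σ : ℂ) + y * I‖ ^ 2) with hG
  have hL : ∫ ξ : ℝ, ‖𝓕 (phiI a σ ν) ξ‖ ^ 2 = ∫ ξ : ℝ, G ((2 * π) * ξ) := by
    refine integral_congr_ae (Filter.Eventually.of_forall fun ξ => ?_)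
    simp only [hG]
    rw [fourier_phiI hσ hsum hbd hθ hν, norm_mul, norm_div, mul_pow, div_pow]
    ring
  have h2π : |(2 * π)⁻¹| = 1 / (2 * π) := by rw [abs_of_pos (by positivity), one_div]
  rw [← hR, ← hP, hL, Measure.integral_comp_mul_left G, h2π, smul_eq_mul]

end MellinPlancherel

namespace Halasz

open MellinPlancherel (psum)
open ArithmeticFunction (vonMangoldt)
open scoped Chebyshev

variable {g : ℕ → ℂ} {N : ℕ}

/-! ### The window weight `w_ν(y) = |ν^s - 1|²/|s|²` on `Re s = 1 + α` -/

/-- The weight of the multiplicative window `(y, νy]` in the Mellin–Plancherel identity on the line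
`Re s = 1 + α`: `w_ν(α, y) = |ν^{1+α+iy} - 1|² / |1+α+iy|²`. [folklore] -/
def wI (ν α y : ℝ) : ℝ :=
  ‖(ν : ℂ) ^ ((1 : ℂ) + α + y * I) - 1‖ ^ 2 / ‖(1 : ℂ) + α + y * I‖ ^ 2

/-- `w_ν ≥ 0`. [folklore] -/
theorem wI_nonneg (ν α y : ℝ) : 0 ≤ wI ν α y := by unfold wI; positivity

/-- `|ν^{1+α+iy} - 1| ≤ 5` for `0 < ν ≤ 2`, `0 ≤ α ≤ 1` (`|ν^s| = ν^{1+α} ≤ 4`). [folklore] -/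
theorem norm_window_cpow_sub_one_le {ν α : ℝ} (hν : 0 < ν) (hν2 : ν ≤ 2) (hα0 : 0 ≤ α) (hα1 : α ≤ 1) (y : ℝ) :
    ‖(ν : ℂ) ^ ((1 : ℂ) + α + y * I) - 1‖ ≤ 5 := by
  have h1 : ‖(ν : ℂ) ^ ((1 : ℂ) + α + y * I)‖ ≤ 4 := by
    rw [Complex.norm_cpow_eq_rpow_re_of_pos hν]
    have hre : ((1 : ℂ) + α + y * I).re = 1 + α := by simp
    rw [hre]
    rcases le_or_gt 1 ν with h1ν | h1ν
    · calc ν ^ (1 + α) ≤ ν ^ (2 : ℝ) := Real.rpow_le_rpow_of_exponent_le h1ν (by linarith)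
        _ = ν ^ 2 := by rw [Real.rpow_two]
        _ ≤ 4 := by nlinarith
    · calc ν ^ (1 + α) ≤ 1 := Real.rpow_le_one hν.le h1ν.le (by linarith)
        _ ≤ 4 := by norm_num
  calc ‖(ν : ℂ) ^ ((1 : ℂ) + α + y * I) - 1‖ ≤ ‖(ν : ℂ) ^ ((1 : ℂ) + α + y * I)‖ + ‖(1 : ℂ)‖ := norm_sub_le _ _
    _ ≤ 4 + 1 := by rw [norm_one]; exact add_le_add h1 le_rfl
    _ = 5 := by norm_num

/-- `w_ν(α, y) ≤ 25/|1+α+iy|²`. [folklore] -/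
theorem wI_le {ν α : ℝ} (hν : 0 < ν) (hν2 : ν ≤ 2) (hα0 : 0 ≤ α) (hα1 : α ≤ 1) (y : ℝ) :
    wI ν α y ≤ 25 / ‖(1 : ℂ) + α + y * I‖ ^ 2 := by
  unfold wI
  refine div_le_div_of_nonneg_right ?_ (by positivity)
  calc ‖(ν : ℂ) ^ ((1 : ℂ) + α + y * I) - 1‖ ^ 2 ≤ 5 ^ 2 :=
        pow_le_pow_left₀ (norm_nonneg _) (norm_window_cpow_sub_one_le hν hν2 hα0 hα1 y) 2
    _ = 25 := by norm_num

/-- `y ↦ w_ν(α, y)` is continuous (`ν > 0`, `α ≥ 0`). [folklore] -/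
theorem continuous_wI {ν α : ℝ} (hν : 0 < ν) (hα0 : 0 ≤ α) : Continuous (wI ν α) := by
  unfold wI
  have hs : Continuous fun y : ℝ => (1 : ℂ) + α + y * I := by fun_prop
  refine Continuous.div ?_ ((hs.norm).pow 2) fun y => ?_
  · refine ((Continuous.sub ?_ continuous_const).norm).pow 2
    exact hs.const_cpow (Or.inl (by exact_mod_cast hν.ne'))
  · have : ((1 : ℂ) + α + y * I) ≠ 0 := by
      intro h; have := congrArg Complex.re h; simp at this; linarith
    positivity

/-! ### Increments of `Λ`-dominated sums over the windows `(y, νy]` -/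

/-- For `y ≤ z`: `A(z) - A(y) = ∑_{⌊y⌋ < n ≤ ⌊z⌋} a_n`. [folklore] -/
theorem psum_sub_psum_eq_sum_Ioc (b : ℕ → ℂ) {y z : ℝ} (hyz : y ≤ z) :
    psum b z - psum b y = ∑ n ∈ Finset.Ioc ⌊y⌋₊ ⌊z⌋₊, b n := by
  have e : ∀ n : ℕ, Finset.Icc 1 n = Finset.Ioc 0 n := fun n => by
    ext m; simp only [Finset.mem_Icc, Finset.mem_Ioc]; omega
  unfold psum
  rw [e, e, ← Finset.sum_Ioc_consecutive b (Nat.zero_le ⌊y⌋₊) (Nat.floor_le_floor hyz)]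
  ring

/-- `ψ(z) - ψ(y) = ∑_{⌊y⌋ < n ≤ ⌊z⌋} Λ(n)` for `y ≤ z`. [folklore] -/
theorem psi_sub_psi_eq {y z : ℝ} (hyz : y ≤ z) :
    ψ z - ψ y = ∑ n ∈ Finset.Ioc ⌊y⌋₊ ⌊z⌋₊, vonMangoldt n := by
  unfold Chebyshev.psi
  rw [← Finset.sum_Ioc_consecutive _ (Nat.zero_le ⌊y⌋₊) (Nat.floor_le_floor hyz)]
  ring

/-- **`Λ`-dominated increments**: if `|b_n| ≤ Λ(n)` then `|B(z) - B(y)| ≤ ψ(z) - ψ(y)` for `y ≤ z`. [folklore] -/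
theorem norm_psum_sub_le_psi_sub {b : ℕ → ℂ} (hb : ∀ n, ‖b n‖ ≤ vonMangoldt n) {y z : ℝ} (hyz : y ≤ z) :
    ‖psum b z - psum b y‖ ≤ ψ z - ψ y := by
  rw [psum_sub_psum_eq_sum_Ioc b hyz, psi_sub_psi_eq hyz]
  exact (norm_sum_le _ _).trans (Finset.sum_le_sum fun n _ => hb n)

/-- `ψ(z) - θ(z) - (ψ(y) - θ(y)) = ∑_{⌊y⌋ < n ≤ ⌊z⌋, n not prime} Λ(n)` for `y ≤ z`. [folklore] -/
theorem psi_sub_theta_sub_eq {y z : ℝ} (hyz : y ≤ z) :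
    (ψ z - θ z) - (ψ y - θ y) = ∑ n ∈ (Finset.Ioc ⌊y⌋₊ ⌊z⌋₊).filter (fun n => ¬ n.Prime), (vonMangoldt n : ℝ) := by
  rw [Chebyshev.psi_sub_theta_eq_sum_not_prime, Chebyshev.psi_sub_theta_eq_sum_not_prime, Finset.sum_filter,
    Finset.sum_filter, Finset.sum_filter,
    ← Finset.sum_Ioc_consecutive _ (Nat.zero_le ⌊y⌋₊) (Nat.floor_le_floor hyz)]
  ring

/-- `ψ - θ` is nondecreasing. [folklore] -/
theorem psi_sub_theta_mono {y z : ℝ} (hyz : y ≤ z) : ψ y - θ y ≤ ψ z - θ z := by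
  have h := psi_sub_theta_sub_eq hyz
  have h0 : 0 ≤ ∑ n ∈ (Finset.Ioc ⌊y⌋₊ ⌊z⌋₊).filter (fun n => ¬ n.Prime), (vonMangoldt n : ℝ) :=
    Finset.sum_nonneg fun n _ => ArithmeticFunction.vonMangoldt_nonneg
  linarith

/-- **Increments supported off the large primes**: if `|b_n| ≤ Λ(n)` and `b_p = 0` for all primes
`p > Q`, then for `Q ≤ y ≤ z`, `|B(z) - B(y)| ≤ (ψ(z) - θ(z)) - (ψ(y) - θ(y))` (only proper prime powers
contribute). [folklore] -/
theorem norm_psum_sub_le_of_vanish {b : ℕ → ℂ} (hb : ∀ n, ‖b n‖ ≤ vonMangoldt n) {Q : ℝ}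
    (hbQ : ∀ n : ℕ, n.Prime → Q < n → b n = 0) {y z : ℝ} (hQy : Q ≤ y) (hyz : y ≤ z) :
    ‖psum b z - psum b y‖ ≤ (ψ z - θ z) - (ψ y - θ y) := by
  rw [psum_sub_psum_eq_sum_Ioc b hyz, psi_sub_theta_sub_eq hyz, Finset.sum_filter]
  refine (norm_sum_le _ _).trans (Finset.sum_le_sum fun n hn => ?_)
  rw [Finset.mem_Ioc] at hn
  by_cases hp : n.Prime
  · have hQn : Q < n := by
      have h1 : y < n := by
        have := Nat.lt_of_floor_lt hn.1
        exact_mod_cast this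
      linarith
    rw [hbQ n hp hQn, norm_zero, if_neg (not_not.mpr hp)]
  · rw [if_pos hp]; exact hb n

/-- `ψ(z) - ψ(y) ≤ (θ(z) - θ(y)) + 2 √z log z` for `1 ≤ y ≤ z` (the proper prime powers up to `z`
contribute at most `ψ(z) - θ(z) ≤ 2√z log z`, Mathlib). [folklore] -/
theorem psi_sub_psi_le {y z : ℝ} (hy : 1 ≤ y) (hyz : y ≤ z) :
    ψ z - ψ y ≤ (θ z - θ y) + 2 * Real.sqrt z * Real.log z := by
  have h1 := Chebyshev.psi_sub_theta_le (hy.trans hyz)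
  have h2 := Chebyshev.theta_le_psi y
  linarith

/-- **The crude increment of `θ`**: `θ(z) - θ(y) ≤ (⌊z⌋ - ⌊y⌋) log z ≤ (z - y + 1) log z` for `1 ≤ y ≤ z`.
[folklore] -/
theorem theta_sub_theta_le {y z : ℝ} (hy : 1 ≤ y) (hyz : y ≤ z) :
    θ z - θ y ≤ (z - y + 1) * Real.log z := by
  have hz0 : 0 < z := by linarith
  have hlogz : 0 ≤ Real.log z := Real.log_nonneg (hy.trans hyz)
  have heq : θ z - θ y = ∑ n ∈ (Finset.Ioc ⌊y⌋₊ ⌊z⌋₊).filter Nat.Prime, Real.log n := by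
    unfold Chebyshev.theta
    rw [Finset.sum_filter, Finset.sum_filter, Finset.sum_filter,
      ← Finset.sum_Ioc_consecutive _ (Nat.zero_le ⌊y⌋₊) (Nat.floor_le_floor hyz)]
    ring
  rw [heq]
  calc ∑ n ∈ (Finset.Ioc ⌊y⌋₊ ⌊z⌋₊).filter Nat.Prime, Real.log n
      ≤ ∑ n ∈ (Finset.Ioc ⌊y⌋₊ ⌊z⌋₊).filter Nat.Prime, Real.log z := by
        refine Finset.sum_le_sum fun n hn => ?_
        rw [Finset.mem_filter, Finset.mem_Ioc] at hn
        have hn0 : (0 : ℝ) < n := by exact_mod_cast hn.2.pos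
        exact Real.log_le_log hn0 ((Nat.cast_le.2 hn.1.2).trans (Nat.floor_le hz0.le))
    _ ≤ ∑ n ∈ Finset.Ioc ⌊y⌋₊ ⌊z⌋₊, Real.log z :=
        Finset.sum_le_sum_of_subset_of_nonneg (Finset.filter_subset Nat.Prime _) (fun n _ _ => hlogz)
    _ = ((⌊z⌋₊ + 1 - (⌊y⌋₊ + 1) : ℕ) : ℝ) * Real.log z := by
        rw [Finset.sum_const, Nat.card_Ioc, nsmul_eq_mul]; push_cast; ring
    _ ≤ (z - y + 1) * Real.log z := by
        refine mul_le_mul_of_nonneg_right ?_ hlogz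
        have h1 : (⌊z⌋₊ : ℝ) ≤ z := Nat.floor_le hz0.le
        have h2 : y < (⌊y⌋₊ : ℝ) + 1 := Nat.lt_floor_add_one y
        have h3 : ((⌊z⌋₊ + 1 - (⌊y⌋₊ + 1) : ℕ) : ℝ) ≤ (⌊z⌋₊ : ℝ) - ⌊y⌋₊ := by
          rcases le_or_gt (⌊y⌋₊ + 1) (⌊z⌋₊ + 1) with h | h
          · rw [Nat.cast_sub h]; push_cast; linarith
          · rw [Nat.sub_eq_zero_of_le h.le]; push_cast
            have : (⌊y⌋₊ : ℝ) ≤ ⌊z⌋₊ := by exact_mod_cast Nat.floor_le_floor hyz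
            linarith
        linarith


/-- **The increment of `θ` from the prime number theorem**: if `|θ(x) - x| ≤ C x/(log x)^6` for `x ≥ 2`
(de la Vallée Poussin, tree: `ChebyshevThetaDeLaValleePoussin_holds.logPow 6`), then for `1 < ν ≤ 2` and
`u ≥ 1 + (3C/(ν-1))^{1/6}`, `θ(ν e^u) - θ(e^u) ≤ 2 (ν - 1) e^u`. [folklore] -/
theorem theta_increment_le {C : ℝ} (hC0 : 0 ≤ C)
    (hC : ∀ x : ℝ, 2 ≤ x → |θ x - x| ≤ C * x / Real.log x ^ (6 : ℝ))
    {ν : ℝ} (hν : 1 < ν) (hν2 : ν ≤ 2) {u : ℝ}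
    (hu : 1 + (3 * C / (ν - 1)) ^ (1 / 6 : ℝ) ≤ u) :
    θ (ν * Real.exp u) - θ (Real.exp u) ≤ 2 * (ν - 1) * Real.exp u := by
  have hν1 : 0 < ν - 1 := by linarith
  set r : ℝ := (3 * C / (ν - 1)) ^ (1 / 6 : ℝ) with hr
  have hr0 : 0 ≤ r := Real.rpow_nonneg (by positivity) _
  have hu1 : 1 ≤ u := by linarith
  set y : ℝ := Real.exp u with hy
  have hy0 : 0 < y := Real.exp_pos u
  have hye : Real.exp 1 ≤ y := Real.exp_le_exp.2 hu1
  have hy2 : 2 ≤ y := le_trans (by have := Real.exp_one_gt_d9; linarith) hye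
  have hνy2 : 2 ≤ ν * y := by nlinarith
  have hlogy : Real.log y = u := by rw [hy, Real.log_exp]
  -- `(log y)^6 ≥ 3C/(ν-1)`
  have hpow : 3 * C / (ν - 1) ≤ Real.log y ^ (6 : ℝ) := by
    rw [hlogy]
    have h1 : r ^ (6 : ℝ) = 3 * C / (ν - 1) := by
      rw [hr, ← Real.rpow_mul (by positivity)]; norm_num
    rw [← h1]
    exact Real.rpow_le_rpow hr0 (by linarith) (by norm_num)
  have hlogy0 : 0 < Real.log y := by rw [hlogy]; linarith
  have hlogy6 : 0 < Real.log y ^ (6 : ℝ) := Real.rpow_pos_of_pos hlogy0 _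
  -- the two PNT bounds
  have h1 := hC (ν * y) hνy2
  have h2 := hC y hy2
  have hlogνy : Real.log y ^ (6 : ℝ) ≤ Real.log (ν * y) ^ (6 : ℝ) := by
    refine Real.rpow_le_rpow hlogy0.le (Real.log_le_log hy0 (by nlinarith)) (by norm_num)
  have h1' : θ (ν * y) ≤ ν * y + C * (ν * y) / Real.log y ^ (6 : ℝ) := by
    have := (abs_le.1 h1).2
    have hmono : C * (ν * y) / Real.log (ν * y) ^ (6 : ℝ) ≤ C * (ν * y) / Real.log y ^ (6 : ℝ) :=
      div_le_div_of_nonneg_left (by positivity) hlogy6 hlogνy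
    linarith
  have h2' : y - C * y / Real.log y ^ (6 : ℝ) ≤ θ y := by
    have := (abs_le.1 h2).1
    linarith
  -- `3 C y/(log y)^6 ≤ (ν - 1) y`
  have hkey : 3 * C * y / Real.log y ^ (6 : ℝ) ≤ (ν - 1) * y := by
    rw [div_le_iff₀ hlogy6]
    have := mul_le_mul_of_nonneg_left hpow (by positivity : 0 ≤ (ν - 1) * y)
    have e : (ν - 1) * y * (3 * C / (ν - 1)) = 3 * C * y := by field_simp
    rw [e] at this
    linarith
  have hsplit : C * (ν * y) / Real.log y ^ (6 : ℝ) + C * y / Real.log y ^ (6 : ℝ) ≤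
      3 * C * y / Real.log y ^ (6 : ℝ) := by
    rw [← add_div]
    refine div_le_div_of_nonneg_right ?_ hlogy6.le
    nlinarith [mul_nonneg (mul_nonneg hC0 hy0.le) (by linarith : (0:ℝ) ≤ 2 - ν)]
  linarith

/-- `(1 + u)² ≤ 8 e^{u/2}` for `u ≥ 0` (`8(1 + u/8)⁴ ≥ (1+u)²` and `1 + u/8 ≤ e^{u/8}`). [folklore] -/
theorem one_add_sq_le_exp_half {u : ℝ} (hu : 0 ≤ u) : (1 + u) ^ 2 ≤ 8 * Real.exp (u / 2) := by
  have h1 : 1 + u / 8 ≤ Real.exp (u / 8) := by have := Real.add_one_le_exp (u / 8); linarith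
  have h2 : (1 + u / 8) ^ 4 ≤ Real.exp (u / 8) ^ 4 := pow_le_pow_left₀ (by positivity) h1 4
  have h3 : Real.exp (u / 8) ^ 4 = Real.exp (u / 2) := by
    rw [← Real.exp_nat_mul]; congr 1; ring
  have h4 : (1 + u) ^ 2 ≤ 8 * (1 + u / 8) ^ 4 := by
    nlinarith [sq_nonneg u, mul_nonneg hu (sq_nonneg u), mul_nonneg (mul_nonneg hu hu) (sq_nonneg u)]
  calc (1 + u) ^ 2 ≤ 8 * (1 + u / 8) ^ 4 := h4
    _ ≤ 8 * Real.exp (u / 2) := by rw [← h3]; exact mul_le_mul_of_nonneg_left h2 (by norm_num)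

/-- The proper-prime-power term: for `u ≥ 0`, `1 < ν ≤ 2`, `0 ≤ α`,
`(2 √(νe^u) log(νe^u))² e^{-2(1+α)u} ≤ 64 e^{-u/2}`. [folklore] -/
theorem sq_sqrt_log_tail_le {ν α u : ℝ} (hν : 1 < ν) (hν2 : ν ≤ 2) (hα0 : 0 ≤ α) (hu : 0 ≤ u) :
    (2 * Real.sqrt (ν * Real.exp u) * Real.log (ν * Real.exp u)) ^ 2 * Real.exp (-(2 * (1 + α) * u)) ≤
      64 * Real.exp (-(u / 2)) := by
  set t : ℝ := ν * Real.exp u with ht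
  have he0 : 0 < Real.exp u := Real.exp_pos u
  have he1 : 1 ≤ Real.exp u := by simpa using Real.one_le_exp hu
  have ht1 : 1 ≤ t := by rw [ht]; nlinarith
  have ht0 : 0 < t := by linarith
  -- `log t ≤ 1 + u`
  have hlog : Real.log t ≤ 1 + u := by
    rw [ht, Real.log_mul (by linarith) he0.ne', Real.log_exp]
    have : Real.log ν ≤ Real.log 2 := Real.log_le_log (by linarith) hν2
    have h2 : Real.log 2 < 1 := by have := Real.log_two_lt_d9; linarith
    linarith
  have hlog0 : 0 ≤ Real.log t := Real.log_nonneg ht1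
  -- `√t ≤ √2 · e^{u/2}` in the form `(√t)² = t ≤ 2 e^u`
  have hsq : Real.sqrt t ^ 2 = t := Real.sq_sqrt ht0.le
  have ht2 : t ≤ 2 * Real.exp u := by rw [ht]; nlinarith
  have hexp : Real.exp u * Real.exp (-(2 * (1 + α) * u)) ≤ Real.exp (-u) := by
    rw [← Real.exp_add, Real.exp_le_exp]; nlinarith
  have hpoly := one_add_sq_le_exp_half hu
  calc (2 * Real.sqrt t * Real.log t) ^ 2 * Real.exp (-(2 * (1 + α) * u))
      = 4 * Real.sqrt t ^ 2 * Real.log t ^ 2 * Real.exp (-(2 * (1 + α) * u)) := by ring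
    _ ≤ 4 * (2 * Real.exp u) * (1 + u) ^ 2 * Real.exp (-(2 * (1 + α) * u)) := by
        rw [hsq]
        gcongr
    _ = 8 * (1 + u) ^ 2 * (Real.exp u * Real.exp (-(2 * (1 + α) * u))) := by ring
    _ ≤ 8 * (8 * Real.exp (u / 2)) * Real.exp (-u) := by gcongr
    _ = 64 * Real.exp (-(u / 2)) := by
        rw [show (64 : ℝ) * Real.exp (-(u / 2)) = 64 * (Real.exp (u / 2) * Real.exp (-u)) by
          rw [← Real.exp_add]; congr 1; congr 1; ring]
        ring

/-- The crude term: for `u ≥ 0`, `0 < ν ≤ 2`, `0 ≤ α`, `2 (θ(νe^u) - θ(e^u))² e^{-2(1+α)u} ≤ 16`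
(`θ(x) ≤ (log 4) x`). [folklore] -/
theorem sq_theta_increment_crude_le {ν α u : ℝ} (hν : 0 < ν) (hν2 : ν ≤ 2) (hα0 : 0 ≤ α) (hu : 0 ≤ u) :
    2 * (θ (ν * Real.exp u) - θ (Real.exp u)) ^ 2 * Real.exp (-(2 * (1 + α) * u)) ≤ 16 := by
  have he0 : 0 < Real.exp u := Real.exp_pos u
  have hθ1 : θ (ν * Real.exp u) ≤ Real.log 4 * (ν * Real.exp u) := Chebyshev.theta_le_log4_mul_x (by positivity)
  have hθ2 : 0 ≤ θ (Real.exp u) := Chebyshev.theta_nonneg _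
  have hθ3 : 0 ≤ θ (ν * Real.exp u) := Chebyshev.theta_nonneg _
  have hlog4 : Real.log 4 ≤ 1.4 := by
    have h2 : Real.log 4 = 2 * Real.log 2 := by
      rw [show (4:ℝ) = 2 ^ 2 by norm_num, Real.log_pow]; ring
    rw [h2]; have := Real.log_two_lt_d9; linarith
  have hlog40 : 0 ≤ Real.log 4 := Real.log_nonneg (by norm_num)
  have hA : θ (ν * Real.exp u) ≤ 2.8 * Real.exp u := by
    refine hθ1.trans ?_
    calc Real.log 4 * (ν * Real.exp u) ≤ 1.4 * (ν * Real.exp u) :=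
          mul_le_mul_of_nonneg_right hlog4 (by positivity)
      _ ≤ 1.4 * (2 * Real.exp u) := by gcongr
      _ = 2.8 * Real.exp u := by ring
  have hB : θ (Real.exp u) ≤ 2.8 * Real.exp u := by
    refine (Chebyshev.theta_le_log4_mul_x he0.le).trans ?_
    calc Real.log 4 * Real.exp u ≤ 1.4 * Real.exp u := mul_le_mul_of_nonneg_right hlog4 he0.le
      _ ≤ 2.8 * Real.exp u := by linarith
  have hd : |θ (ν * Real.exp u) - θ (Real.exp u)| ≤ 2.8 * Real.exp u := by
    rw [abs_le]; constructor
    · linarith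
    · linarith
  have hsq : (θ (ν * Real.exp u) - θ (Real.exp u)) ^ 2 ≤ (2.8 * Real.exp u) ^ 2 := by
    calc (θ (ν * Real.exp u) - θ (Real.exp u)) ^ 2 = |θ (ν * Real.exp u) - θ (Real.exp u)| ^ 2 := (sq_abs _).symm
      _ ≤ (2.8 * Real.exp u) ^ 2 := pow_le_pow_left₀ (abs_nonneg _) hd 2
  have hexp : Real.exp u ^ 2 * Real.exp (-(2 * (1 + α) * u)) ≤ 1 := by
    rw [← Real.exp_nat_mul, ← Real.exp_add, Real.exp_le_one_iff]; push_cast; nlinarith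
  calc 2 * (θ (ν * Real.exp u) - θ (Real.exp u)) ^ 2 * Real.exp (-(2 * (1 + α) * u))
      ≤ 2 * (2.8 * Real.exp u) ^ 2 * Real.exp (-(2 * (1 + α) * u)) := by gcongr
    _ = 15.68 * (Real.exp u ^ 2 * Real.exp (-(2 * (1 + α) * u))) := by ring
    _ ≤ 15.68 * 1 := by gcongr
    _ ≤ 16 := by norm_num

/-! ### The interval mean square of a `Λ`-dominated sequence -/

/-- The threshold `u₁ = 1 + (3C/(ν-1))^{1/6}` beyond which the prime number theorem controls the
increments of `θ` over `(y, νy]`. [folklore] -/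
def uPNT (C ν : ℝ) : ℝ := 1 + (3 * C / (ν - 1)) ^ (1 / 6 : ℝ)

/-- `u₁ ≥ 1`. [folklore] -/
theorem one_le_uPNT {C ν : ℝ} (hC0 : 0 ≤ C) (hν : 1 < ν) : 1 ≤ uPNT C ν := by
  unfold uPNT
  have : 0 ≤ (3 * C / (ν - 1)) ^ (1 / 6 : ℝ) := Real.rpow_nonneg (div_nonneg (by positivity) (by linarith)) _
  linarith

/-- `u₁ ≤ (1 + (3C)^{1/6}) (ν - 1)^{-1/6}` for `1 < ν ≤ 2`. [folklore] -/
theorem uPNT_le {C ν : ℝ} (hC0 : 0 ≤ C) (hν : 1 < ν) (hν2 : ν ≤ 2) :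
    uPNT C ν ≤ (1 + (3 * C) ^ (1 / 6 : ℝ)) * (ν - 1) ^ (-(1 / 6 : ℝ)) := by
  unfold uPNT
  have hν1 : 0 < ν - 1 := by linarith
  have h1 : (3 * C / (ν - 1)) ^ (1 / 6 : ℝ) = (3 * C) ^ (1 / 6 : ℝ) * (ν - 1) ^ (-(1 / 6 : ℝ)) := by
    rw [div_eq_mul_inv, Real.mul_rpow (by positivity) (by positivity), Real.rpow_neg hν1.le, Real.inv_rpow hν1.le]
  have h2 : 1 ≤ (ν - 1) ^ (-(1 / 6 : ℝ)) := by
    rw [Real.rpow_neg hν1.le]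
    rw [one_le_inv_iff₀]
    exact ⟨Real.rpow_pos_of_pos hν1 _, Real.rpow_le_one hν1.le (by linarith) (by norm_num)⟩
  have h3 : 0 ≤ (3 * C) ^ (1 / 6 : ℝ) := Real.rpow_nonneg (by positivity) _
  rw [h1]
  nlinarith

/-- **The interval mean square of a `Λ`-dominated sequence.**  Let `|b_n| ≤ Λ(n)`, `1 < ν ≤ 2`,
`0 < α`, and let `C` be a constant of the prime number theorem `|θ(x) - x| ≤ C x/(log x)^6` (`x ≥ 2`).
Then, with `B(y) = ∑_{n ≤ y} b_n` and `u₁ = uPNT C ν`,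
`∫_ℝ |B(νe^u) - B(e^u)|² e^{-2(1+α)u} du ≤ 4 (ν-1)²/α + 16 u₁ + 256`:
the increments are `≤ ψ(νy) - ψ(y) ≤ (θ(νy) - θ(y)) + 2√(νy) log(νy)`; the `θ`-increment is `≤ 2(ν-1) y`
beyond `e^{u₁}` (prime number theorem) and `≤ (log 4) ν y` before, and the proper prime powers give
`64 e^{-u/2}`.  Only the `1/α`-term carries the factor `(ν - 1)²`, which is what the short-interval
Halász theorem needs. [folklore] -/
theorem intervalMeanSquare_le {C : ℝ} (hC0 : 0 ≤ C)
    (hC : ∀ x : ℝ, 2 ≤ x → |θ x - x| ≤ C * x / Real.log x ^ (6 : ℝ))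
    {b : ℕ → ℂ} (hb : ∀ n, ‖b n‖ ≤ vonMangoldt n) {ν : ℝ} (hν : 1 < ν) (hν2 : ν ≤ 2)
    {α : ℝ} (hα : 0 < α) :
    ∫ u : ℝ, ‖psum b (ν * Real.exp u) - psum b (Real.exp u)‖ ^ 2 * Real.exp (-(2 * (1 + α) * u)) ≤
      4 * (ν - 1) ^ 2 / α + 16 * uPNT C ν + 256 := by
  set u₁ : ℝ := uPNT C ν with hu₁
  have hu₁1 : 1 ≤ u₁ := one_le_uPNT hC0 hν
  have hν0 : 0 < ν := by linarith
  set f : ℝ → ℝ := fun u => ‖psum b (ν * Real.exp u) - psum b (Real.exp u)‖ ^ 2 *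
    Real.exp (-(2 * (1 + α) * u)) with hf
  -- the three pieces of the majorant
  set M₁ : ℝ → ℝ := (Set.Ici (0 : ℝ)).indicator (fun u => 128 * Real.exp (-(1 / 2) * u)) with hM₁
  set M₂ : ℝ → ℝ := (Set.Icc (0 : ℝ) u₁).indicator (fun _ => (16 : ℝ)) with hM₂
  set M₃ : ℝ → ℝ := (Set.Ioi u₁).indicator (fun u => 8 * (ν - 1) ^ 2 * Real.exp (-(2 * α) * u)) with hM₃
  -- pointwise bounds on the increment
  have hincr : ∀ u : ℝ, 0 ≤ u → ‖psum b (ν * Real.exp u) - psum b (Real.exp u)‖ ≤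
      (θ (ν * Real.exp u) - θ (Real.exp u)) + 2 * Real.sqrt (ν * Real.exp u) * Real.log (ν * Real.exp u) := by
    intro u hu
    have he1 : 1 ≤ Real.exp u := by simpa using Real.one_le_exp hu
    have hyz : Real.exp u ≤ ν * Real.exp u := by nlinarith [Real.exp_pos u]
    exact (norm_psum_sub_le_psi_sub hb hyz).trans (psi_sub_psi_le he1 hyz)
  have hneg : ∀ u : ℝ, u < 0 → f u = 0 := by
    intro u hu
    have hyz : Real.exp u ≤ ν * Real.exp u := by nlinarith [Real.exp_pos u]
    have h1 := norm_psum_sub_le_psi_sub hb hyz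
    have h2 : ψ (ν * Real.exp u) = 0 := by
      refine Chebyshev.psi_eq_zero_of_lt_two ?_
      have : Real.exp u < 1 := Real.exp_lt_one_iff.mpr hu
      nlinarith
    have h3 : 0 ≤ ψ (Real.exp u) := Chebyshev.psi_nonneg _
    have h4 : ‖psum b (ν * Real.exp u) - psum b (Real.exp u)‖ = 0 :=
      le_antisymm (by linarith) (norm_nonneg _)
    simp only [hf, h4]; ring
  have hle : ∀ u : ℝ, f u ≤ M₁ u + M₂ u + M₃ u := by
    intro u
    rcases lt_or_ge u 0 with hu0 | hu0
    · rw [hneg u hu0]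
      have h1 : 0 ≤ M₁ u := Set.indicator_nonneg (fun v _ => by positivity) u
      have h2 : 0 ≤ M₂ u := Set.indicator_nonneg (fun v _ => by positivity) u
      have h3 : 0 ≤ M₃ u := Set.indicator_nonneg (fun v _ => by positivity) u
      linarith
    · -- `u ≥ 0`: `f ≤ 2a²E + 2b²E`, `2b²E ≤ 128 e^{-u/2} = M₁ u`
      set a : ℝ := θ (ν * Real.exp u) - θ (Real.exp u) with ha
      set c : ℝ := 2 * Real.sqrt (ν * Real.exp u) * Real.log (ν * Real.exp u) with hc
      set E : ℝ := Real.exp (-(2 * (1 + α) * u)) with hE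
      have hE0 : 0 ≤ E := (Real.exp_pos _).le
      have hn := hincr u hu0
      have hfle : f u ≤ 2 * a ^ 2 * E + 2 * c ^ 2 * E := by
        simp only [hf]
        have h0 : 0 ≤ ‖psum b (ν * Real.exp u) - psum b (Real.exp u)‖ := norm_nonneg _
        have h1 : ‖psum b (ν * Real.exp u) - psum b (Real.exp u)‖ ^ 2 ≤ (a + c) ^ 2 :=
          pow_le_pow_left₀ h0 hn 2
        have h2 : (a + c) ^ 2 ≤ 2 * a ^ 2 + 2 * c ^ 2 := by nlinarith [sq_nonneg (a - c)]
        calc ‖psum b (ν * Real.exp u) - psum b (Real.exp u)‖ ^ 2 * E ≤ (2 * a ^ 2 + 2 * c ^ 2) * E :=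
              mul_le_mul_of_nonneg_right (h1.trans h2) hE0
          _ = 2 * a ^ 2 * E + 2 * c ^ 2 * E := by ring
      have hM₁u : M₁ u = 128 * Real.exp (-(1 / 2) * u) := by
        rw [hM₁, Set.indicator_of_mem (Set.mem_Ici.2 hu0)]
      have hcE : 2 * c ^ 2 * E ≤ M₁ u := by
        rw [hM₁u]
        have := sq_sqrt_log_tail_le (α := α) hν hν2 hα.le hu0
        rw [← hc, ← hE] at this
        have e : Real.exp (-(u / 2)) = Real.exp (-(1 / 2) * u) := by congr 1; ring
        rw [e] at this
        linarith
      rcases le_or_gt u u₁ with hu1 | hu1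
      · -- crude region
        have hM₂u : M₂ u = 16 := by rw [hM₂, Set.indicator_of_mem (Set.mem_Icc.2 ⟨hu0, hu1⟩)]
        have hM₃0 : 0 ≤ M₃ u := Set.indicator_nonneg (fun v _ => by positivity) u
        have haE : 2 * a ^ 2 * E ≤ 16 := sq_theta_increment_crude_le (α := α) hν0 hν2 hα.le hu0
        linarith
      · -- PNT region
        have hM₂0 : 0 ≤ M₂ u := Set.indicator_nonneg (fun v _ => by positivity) u
        have hM₃u : M₃ u = 8 * (ν - 1) ^ 2 * Real.exp (-(2 * α) * u) := by
          rw [hM₃, Set.indicator_of_mem (Set.mem_Ioi.2 hu1)]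
        have hθ := theta_increment_le hC0 hC hν hν2 (u := u) (by rw [← uPNT, ← hu₁]; exact hu1.le)
        have ha0 : 0 ≤ a := by
          rw [ha]; have := Chebyshev.theta_mono (show Real.exp u ≤ ν * Real.exp u by nlinarith [Real.exp_pos u]); linarith
        have haE : 2 * a ^ 2 * E ≤ 8 * (ν - 1) ^ 2 * Real.exp (-(2 * α) * u) := by
          have h1 : a ^ 2 ≤ (2 * (ν - 1) * Real.exp u) ^ 2 := pow_le_pow_left₀ ha0 hθ 2
          have h2 : Real.exp u ^ 2 * E = Real.exp (-(2 * α) * u) := by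
            rw [hE, ← Real.exp_nat_mul, ← Real.exp_add]; congr 1; push_cast; ring
          calc 2 * a ^ 2 * E ≤ 2 * (2 * (ν - 1) * Real.exp u) ^ 2 * E := by gcongr
            _ = 8 * (ν - 1) ^ 2 * (Real.exp u ^ 2 * E) := by ring
            _ = 8 * (ν - 1) ^ 2 * Real.exp (-(2 * α) * u) := by rw [h2]
        linarith
  -- integrability of the majorant and its integral
  have hI₁ : Integrable M₁ ∧ ∫ u, M₁ u = 256 := by
    have hIoi : IntegrableOn (fun u => 128 * Real.exp (-(1 / 2) * u)) (Set.Ioi (0 : ℝ)) :=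
      (integrableOn_exp_mul_Ioi (by norm_num : -(1 / 2 : ℝ) < 0) 0).const_mul 128
    have hIci : IntegrableOn (fun u => 128 * Real.exp (-(1 / 2) * u)) (Set.Ici (0 : ℝ)) :=
      (integrableOn_Ici_iff_integrableOn_Ioi).2 hIoi
    refine ⟨(integrable_indicator_iff measurableSet_Ici).2 hIci, ?_⟩
    rw [hM₁, integral_indicator measurableSet_Ici, integral_Ici_eq_integral_Ioi, integral_const_mul,
      integral_exp_mul_Ioi (by norm_num : -(1 / 2 : ℝ) < 0) 0]
    norm_num
  have hI₂ : Integrable M₂ ∧ ∫ u, M₂ u = 16 * u₁ := by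
    have hfin : volume (Set.Icc (0 : ℝ) u₁) < ⊤ := measure_Icc_lt_top
    refine ⟨(integrable_indicator_iff measurableSet_Icc).2 (integrableOn_const hfin.ne), ?_⟩
    rw [hM₂, integral_indicator measurableSet_Icc, setIntegral_const, Real.volume_real_Icc_of_le (by linarith),
      smul_eq_mul]
    ring
  have hI₃ : Integrable M₃ ∧ ∫ u, M₃ u ≤ 4 * (ν - 1) ^ 2 / α := by
    have hIoi : IntegrableOn (fun u => 8 * (ν - 1) ^ 2 * Real.exp (-(2 * α) * u)) (Set.Ioi u₁) :=
      (integrableOn_exp_mul_Ioi (by linarith : -(2 * α) < 0) u₁).const_mul _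
    refine ⟨(integrable_indicator_iff measurableSet_Ioi).2 hIoi, ?_⟩
    rw [hM₃, integral_indicator measurableSet_Ioi, integral_const_mul,
      integral_exp_mul_Ioi (by linarith : -(2 * α) < 0) u₁]
    have h1 : Real.exp (-(2 * α) * u₁) ≤ 1 := by
      rw [Real.exp_le_one_iff]; nlinarith
    have h2 : -Real.exp (-(2 * α) * u₁) / -(2 * α) = Real.exp (-(2 * α) * u₁) / (2 * α) := by
      rw [neg_div_neg_eq]
    rw [h2]
    calc 8 * (ν - 1) ^ 2 * (Real.exp (-(2 * α) * u₁) / (2 * α)) ≤ 8 * (ν - 1) ^ 2 * (1 / (2 * α)) := by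
          gcongr
      _ = 4 * (ν - 1) ^ 2 / α := by field_simp; ring
  have hMint : Integrable (fun u => M₁ u + M₂ u + M₃ u) := (hI₁.1.add hI₂.1).add hI₃.1
  have hf0 : 0 ≤ᵐ[volume] f := Filter.Eventually.of_forall fun u => by simp only [hf]; positivity
  calc ∫ u, f u ≤ ∫ u, (M₁ u + M₂ u + M₃ u) := integral_mono_of_nonneg hf0 hMint (Filter.Eventually.of_forall hle)
    _ = (∫ u, M₁ u) + (∫ u, M₂ u) + ∫ u, M₃ u := by
        have e1 : ∫ u, (M₁ u + M₂ u + M₃ u) = (∫ u, (M₁ u + M₂ u)) + ∫ u, M₃ u :=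
          integral_add (hI₁.1.add hI₂.1) hI₃.1
        have e2 : ∫ u, (M₁ u + M₂ u) = (∫ u, M₁ u) + ∫ u, M₂ u := integral_add hI₁.1 hI₂.1
        rw [e1, e2]
    _ ≤ 256 + 16 * u₁ + 4 * (ν - 1) ^ 2 / α := by rw [hI₁.2, hI₂.2]; linarith [hI₃.2]
    _ = 4 * (ν - 1) ^ 2 / α + 16 * u₁ + 256 := by ring

/-- **The interval mean square of a `Λ`-dominated sequence living on small primes.**  As
`intervalMeanSquare_le`, but if moreover `b_p = 0` for all primes `p > Q` (`Q ≥ 1`; e.g. the block piece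
`g̃Λ1_{blk}` of a block of primes `≤ Q`), the `θ`-increments vanish beyond `Q` and
`∫_ℝ |B(νe^u) - B(e^u)|² e^{-2(1+α)u} du ≤ 8 (ν-1)² log Q + 16 u₁ + 256` — no `1/α` at all. [folklore] -/
theorem intervalMeanSquare_le_of_vanish {C : ℝ} (hC0 : 0 ≤ C)
    (hC : ∀ x : ℝ, 2 ≤ x → |θ x - x| ≤ C * x / Real.log x ^ (6 : ℝ))
    {b : ℕ → ℂ} (hb : ∀ n, ‖b n‖ ≤ vonMangoldt n) {Q : ℝ} (hQ : 1 ≤ Q)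
    (hbQ : ∀ n : ℕ, n.Prime → Q < n → b n = 0) {ν : ℝ} (hν : 1 < ν) (hν2 : ν ≤ 2)
    {α : ℝ} (hα : 0 < α) :
    ∫ u : ℝ, ‖psum b (ν * Real.exp u) - psum b (Real.exp u)‖ ^ 2 * Real.exp (-(2 * (1 + α) * u)) ≤
      8 * (ν - 1) ^ 2 * Real.log Q + 16 * uPNT C ν + 256 := by
  set u₁ : ℝ := uPNT C ν with hu₁
  have hu₁1 : 1 ≤ u₁ := one_le_uPNT hC0 hν
  have hν0 : 0 < ν := by linarith
  have hQ0 : 0 < Q := by linarith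
  have hlogQ : 0 ≤ Real.log Q := Real.log_nonneg hQ
  set f : ℝ → ℝ := fun u => ‖psum b (ν * Real.exp u) - psum b (Real.exp u)‖ ^ 2 *
    Real.exp (-(2 * (1 + α) * u)) with hf
  -- the three pieces of the majorant
  set M₁ : ℝ → ℝ := (Set.Ici (0 : ℝ)).indicator (fun u => 128 * Real.exp (-(1 / 2) * u)) with hM₁
  set M₂ : ℝ → ℝ := (Set.Icc (0 : ℝ) u₁).indicator (fun _ => (16 : ℝ)) with hM₂
  set M₃ : ℝ → ℝ := (Set.Ioc u₁ (Real.log Q)).indicator (fun _ => 8 * (ν - 1) ^ 2) with hM₃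
  -- pointwise bounds on the increment
  have hincr : ∀ u : ℝ, 0 ≤ u → ‖psum b (ν * Real.exp u) - psum b (Real.exp u)‖ ≤
      (θ (ν * Real.exp u) - θ (Real.exp u)) + 2 * Real.sqrt (ν * Real.exp u) * Real.log (ν * Real.exp u) := by
    intro u hu
    have he1 : 1 ≤ Real.exp u := by simpa using Real.one_le_exp hu
    have hyz : Real.exp u ≤ ν * Real.exp u := by nlinarith [Real.exp_pos u]
    exact (norm_psum_sub_le_psi_sub hb hyz).trans (psi_sub_psi_le he1 hyz)
  have hincrQ : ∀ u : ℝ, Real.log Q ≤ u → ‖psum b (ν * Real.exp u) - psum b (Real.exp u)‖ ≤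
      2 * Real.sqrt (ν * Real.exp u) * Real.log (ν * Real.exp u) := by
    intro u hu
    have hQy : Q ≤ Real.exp u := by
      calc Q = Real.exp (Real.log Q) := (Real.exp_log hQ0).symm
        _ ≤ Real.exp u := Real.exp_le_exp.2 hu
    have hyz : Real.exp u ≤ ν * Real.exp u := by nlinarith [Real.exp_pos u]
    have h1 := norm_psum_sub_le_of_vanish hb hbQ hQy hyz
    have h2 : 0 ≤ ψ (Real.exp u) - θ (Real.exp u) := by linarith [Chebyshev.theta_le_psi (Real.exp u)]
    have h3 : ψ (ν * Real.exp u) - θ (ν * Real.exp u) ≤ 2 * Real.sqrt (ν * Real.exp u) * Real.log (ν * Real.exp u) :=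
      Chebyshev.psi_sub_theta_le (by nlinarith [hQ.trans hQy])
    linarith
  have hneg : ∀ u : ℝ, u < 0 → f u = 0 := by
    intro u hu
    have hyz : Real.exp u ≤ ν * Real.exp u := by nlinarith [Real.exp_pos u]
    have h1 := norm_psum_sub_le_psi_sub hb hyz
    have h2 : ψ (ν * Real.exp u) = 0 := by
      refine Chebyshev.psi_eq_zero_of_lt_two ?_
      have : Real.exp u < 1 := Real.exp_lt_one_iff.mpr hu
      nlinarith
    have h3 : 0 ≤ ψ (Real.exp u) := Chebyshev.psi_nonneg _
    have h4 : ‖psum b (ν * Real.exp u) - psum b (Real.exp u)‖ = 0 :=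
      le_antisymm (by linarith) (norm_nonneg _)
    simp only [hf, h4]; ring
  have hle : ∀ u : ℝ, f u ≤ M₁ u + M₂ u + M₃ u := by
    intro u
    have hM₁0 : 0 ≤ M₁ u := Set.indicator_nonneg (fun v _ => by positivity) u
    have hM₂0 : 0 ≤ M₂ u := Set.indicator_nonneg (fun v _ => by positivity) u
    have hM₃0 : 0 ≤ M₃ u := Set.indicator_nonneg (fun v _ => by positivity) u
    rcases lt_or_ge u 0 with hu0 | hu0
    · rw [hneg u hu0]; linarith
    · set a : ℝ := θ (ν * Real.exp u) - θ (Real.exp u) with ha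
      set c : ℝ := 2 * Real.sqrt (ν * Real.exp u) * Real.log (ν * Real.exp u) with hc
      set E : ℝ := Real.exp (-(2 * (1 + α) * u)) with hE
      have hE0 : 0 ≤ E := (Real.exp_pos _).le
      have hM₁u : M₁ u = 128 * Real.exp (-(1 / 2) * u) := by
        rw [hM₁, Set.indicator_of_mem (Set.mem_Ici.2 hu0)]
      have hcE1 : c ^ 2 * E ≤ 64 * Real.exp (-(1 / 2) * u) := by
        have := sq_sqrt_log_tail_le (α := α) hν hν2 hα.le hu0
        rw [← hc, ← hE] at this
        have e : Real.exp (-(u / 2)) = Real.exp (-(1 / 2) * u) := by congr 1; ring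
        rwa [e] at this
      have hcE : 2 * c ^ 2 * E ≤ M₁ u := by rw [hM₁u]; linarith
      have hfle : f u ≤ 2 * a ^ 2 * E + 2 * c ^ 2 * E := by
        simp only [hf]
        have h0 : 0 ≤ ‖psum b (ν * Real.exp u) - psum b (Real.exp u)‖ := norm_nonneg _
        have h1 : ‖psum b (ν * Real.exp u) - psum b (Real.exp u)‖ ^ 2 ≤ (a + c) ^ 2 :=
          pow_le_pow_left₀ h0 (hincr u hu0) 2
        have h2 : (a + c) ^ 2 ≤ 2 * a ^ 2 + 2 * c ^ 2 := by nlinarith [sq_nonneg (a - c)]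
        calc ‖psum b (ν * Real.exp u) - psum b (Real.exp u)‖ ^ 2 * E ≤ (2 * a ^ 2 + 2 * c ^ 2) * E :=
              mul_le_mul_of_nonneg_right (h1.trans h2) hE0
          _ = 2 * a ^ 2 * E + 2 * c ^ 2 * E := by ring
      rcases le_or_gt u u₁ with hu1 | hu1
      · -- crude region
        have hM₂u : M₂ u = 16 := by rw [hM₂, Set.indicator_of_mem (Set.mem_Icc.2 ⟨hu0, hu1⟩)]
        have haE : 2 * a ^ 2 * E ≤ 16 := sq_theta_increment_crude_le (α := α) hν0 hν2 hα.le hu0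
        linarith
      · rcases le_or_gt u (Real.log Q) with huQ | huQ
        · -- PNT region below `log Q`
          have hM₃u : M₃ u = 8 * (ν - 1) ^ 2 := by
            rw [hM₃, Set.indicator_of_mem (Set.mem_Ioc.2 ⟨hu1, huQ⟩)]
          have hθ := theta_increment_le hC0 hC hν hν2 (u := u) (by rw [← uPNT, ← hu₁]; exact hu1.le)
          have ha0 : 0 ≤ a := by
            rw [ha]; have := Chebyshev.theta_mono (show Real.exp u ≤ ν * Real.exp u by nlinarith [Real.exp_pos u]); linarith
          have haE : 2 * a ^ 2 * E ≤ 8 * (ν - 1) ^ 2 := by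
            have h1 : a ^ 2 ≤ (2 * (ν - 1) * Real.exp u) ^ 2 := pow_le_pow_left₀ ha0 hθ 2
            have h2 : Real.exp u ^ 2 * E ≤ 1 := by
              rw [hE, ← Real.exp_nat_mul, ← Real.exp_add, Real.exp_le_one_iff]; push_cast; nlinarith
            calc 2 * a ^ 2 * E ≤ 2 * (2 * (ν - 1) * Real.exp u) ^ 2 * E := by gcongr
              _ = 8 * (ν - 1) ^ 2 * (Real.exp u ^ 2 * E) := by ring
              _ ≤ 8 * (ν - 1) ^ 2 * 1 := by gcongr
              _ = 8 * (ν - 1) ^ 2 := mul_one _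
          linarith
        · -- beyond `log Q`: only proper prime powers
          have hfle' : f u ≤ c ^ 2 * E := by
            simp only [hf]
            exact mul_le_mul_of_nonneg_right (pow_le_pow_left₀ (norm_nonneg _) (hincrQ u huQ.le) 2) hE0
          have : c ^ 2 * E ≤ M₁ u := by
            rw [hM₁u]
            have h64 : 0 ≤ 64 * Real.exp (-(1 / 2) * u) := by positivity
            linarith
          linarith
  -- integrability of the majorant and its integral
  have hI₁ : Integrable M₁ ∧ ∫ u, M₁ u = 256 := by
    have hIoi : IntegrableOn (fun u => 128 * Real.exp (-(1 / 2) * u)) (Set.Ioi (0 : ℝ)) :=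
      (integrableOn_exp_mul_Ioi (by norm_num : -(1 / 2 : ℝ) < 0) 0).const_mul 128
    have hIci : IntegrableOn (fun u => 128 * Real.exp (-(1 / 2) * u)) (Set.Ici (0 : ℝ)) :=
      (integrableOn_Ici_iff_integrableOn_Ioi).2 hIoi
    refine ⟨(integrable_indicator_iff measurableSet_Ici).2 hIci, ?_⟩
    rw [hM₁, integral_indicator measurableSet_Ici, integral_Ici_eq_integral_Ioi, integral_const_mul,
      integral_exp_mul_Ioi (by norm_num : -(1 / 2 : ℝ) < 0) 0]
    norm_num
  have hI₂ : Integrable M₂ ∧ ∫ u, M₂ u = 16 * u₁ := by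
    have hfin : volume (Set.Icc (0 : ℝ) u₁) < ⊤ := measure_Icc_lt_top
    refine ⟨(integrable_indicator_iff measurableSet_Icc).2 (integrableOn_const hfin.ne), ?_⟩
    rw [hM₂, integral_indicator measurableSet_Icc, setIntegral_const, Real.volume_real_Icc_of_le (by linarith),
      smul_eq_mul]
    ring
  have hI₃ : Integrable M₃ ∧ ∫ u, M₃ u ≤ 8 * (ν - 1) ^ 2 * Real.log Q := by
    have hfin : volume (Set.Ioc u₁ (Real.log Q)) < ⊤ := measure_Ioc_lt_top
    refine ⟨(integrable_indicator_iff measurableSet_Ioc).2 (integrableOn_const hfin.ne), ?_⟩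
    rw [hM₃, integral_indicator measurableSet_Ioc, setIntegral_const, Real.volume_real_Ioc, smul_eq_mul]
    have h1 : max (Real.log Q - u₁) 0 ≤ Real.log Q := max_le (by linarith) hlogQ
    have h2 : 0 ≤ 8 * (ν - 1) ^ 2 := by positivity
    calc max (Real.log Q - u₁) 0 * (8 * (ν - 1) ^ 2) ≤ Real.log Q * (8 * (ν - 1) ^ 2) :=
          mul_le_mul_of_nonneg_right h1 h2
      _ = 8 * (ν - 1) ^ 2 * Real.log Q := by ring
  have hMint : Integrable (fun u => M₁ u + M₂ u + M₃ u) := (hI₁.1.add hI₂.1).add hI₃.1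
  have hf0 : 0 ≤ᵐ[volume] f := Filter.Eventually.of_forall fun u => by simp only [hf]; positivity
  calc ∫ u, f u ≤ ∫ u, (M₁ u + M₂ u + M₃ u) := integral_mono_of_nonneg hf0 hMint (Filter.Eventually.of_forall hle)
    _ = (∫ u, M₁ u) + (∫ u, M₂ u) + ∫ u, M₃ u := by
        have e1 : ∫ u, (M₁ u + M₂ u + M₃ u) = (∫ u, (M₁ u + M₂ u)) + ∫ u, M₃ u :=
          integral_add (hI₁.1.add hI₂.1) hI₃.1
        have e2 : ∫ u, (M₁ u + M₂ u) = (∫ u, M₁ u) + ∫ u, M₂ u := integral_add hI₁.1 hI₂.1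
        rw [e1, e2]
    _ ≤ 256 + 16 * u₁ + 8 * (ν - 1) ^ 2 * Real.log Q := by rw [hI₁.2, hI₂.2]; linarith [hI₃.2]
    _ = 8 * (ν - 1) ^ 2 * Real.log Q + 16 * u₁ + 256 := by ring

/-! ### Interval mean squares on the line `Re s = 1 + α` via Mellin–Plancherel -/

/-- **The window-weighted mean square of a `Λ`-dominated Dirichlet series** (outside piece): for
`|g'| ≤ 1` and `b = g̃'Λ` (`mulVM`), `1 < ν ≤ 2`, `0 < α`,
`∫_ℝ |P_b(1+α+iy)|² w_ν(α,y) dy = 2π ∫ |B(νe^u) - B(e^u)|² e^{-2(1+α)u} du ≤ 2π (4(ν-1)²/α + 16u₁ + 256)`.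
[folklore] -/
theorem integral_normSq_mulVM_wI_le {C : ℝ} (hC0 : 0 ≤ C)
    (hC : ∀ x : ℝ, 2 ≤ x → |θ x - x| ≤ C * x / Real.log x ^ (6 : ℝ))
    {g' : ℕ → ℂ} (hgb : ∀ n, ‖g' n‖ ≤ 1) {ν : ℝ} (hν : 1 < ν) (hν2 : ν ≤ 2) {α : ℝ} (hα : 0 < α) :
    ∫ y : ℝ, ‖LSeries (mulVM g' N) (1 + α + y * I)‖ ^ 2 * wI ν α y ≤
      2 * π * (4 * (ν - 1) ^ 2 / α + 16 * uPNT C ν + 256) := by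
  have hP := MellinPlancherel.integral_norm_sq_psum_interval_exp (a := mulVM g' N) (σ := 1 + α)
    (by linarith : (0:ℝ) < 1 + α) (summable_norm_mulVM_div_rpow hgb (by linarith))
    (show (1:ℝ) < 1 + α by linarith) (fun y hy => norm_psum_mulVM_le hgb y hy) (ν := ν) (by linarith)
  simp only [ofReal_one_add] at hP
  have hV := intervalMeanSquare_le hC0 hC (b := mulVM g' N) (fun n => norm_mulVM_le hgb n) hν hν2 hα
  have heq : ∫ y : ℝ, ‖LSeries (mulVM g' N) (1 + α + y * I)‖ ^ 2 * wI ν α y =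
      2 * π * ∫ u : ℝ, ‖psum (mulVM g' N) (ν * Real.exp u) - psum (mulVM g' N) (Real.exp u)‖ ^ 2 *
        Real.exp (-(2 * (1 + α) * u)) := by
    rw [hP]
    have hπ : (2 : ℝ) * π ≠ 0 := by positivity
    rw [← mul_assoc, show (2 : ℝ) * π * (1 / (2 * π)) = 1 by field_simp, one_mul]
    rfl
  rw [heq]
  exact mul_le_mul_of_nonneg_left hV (by positivity)

namespace Restricted

variable {ι : Type*} {𝓙 : Finset ι} {blk : ι → Finset ℕ}

/-- The block piece `g̃Λ1_{blk}` vanishes at primes above the block: if all primes of `P` are `≤ Q` then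
`vmIn P g N p = 0` for every prime `p > Q`. [folklore] -/
theorem vmIn_prime_eq_zero {P : Finset ℕ} (hPp : ∀ p ∈ P, p.Prime) {Q : ℝ} (hPQ : ∀ p ∈ P, (p : ℝ) ≤ Q)
    {n : ℕ} (hn : n.Prime) (hQn : Q < n) : vmIn P g N n = 0 := by
  refine vmIn_eq_zero_of_forall P fun q hq hqn => ?_
  have hqn' : q = n := (Nat.prime_dvd_prime_iff_eq (hPp q hq) hn).1 hqn
  have := hPQ q hq
  rw [hqn'] at this
  linarith

/-- **The window-weighted mean square of a block piece**: for a block `P` of primes `≤ Q` (`Q ≥ 1`),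
`∫_ℝ |P_i(1+α+iy)|² w_ν(α,y) dy ≤ 2π (8(ν-1)² log Q + 16u₁ + 256)`. [folklore] -/
theorem integral_normSq_vmIn_wI_le {C : ℝ} (hC0 : 0 ≤ C)
    (hC : ∀ x : ℝ, 2 ≤ x → |θ x - x| ≤ C * x / Real.log x ^ (6 : ℝ))
    (hgb : ∀ n, ‖g n‖ ≤ 1) {P : Finset ℕ} (hPp : ∀ p ∈ P, p.Prime) {Q : ℝ} (hQ : 1 ≤ Q)
    (hPQ : ∀ p ∈ P, (p : ℝ) ≤ Q) {ν : ℝ} (hν : 1 < ν) (hν2 : ν ≤ 2) {α : ℝ} (hα : 0 < α) :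
    ∫ y : ℝ, ‖LSeries (vmIn P g N) (1 + α + y * I)‖ ^ 2 * wI ν α y ≤
      2 * π * (8 * (ν - 1) ^ 2 * Real.log Q + 16 * uPNT C ν + 256) := by
  have hP := MellinPlancherel.integral_norm_sq_psum_interval_exp (a := vmIn P g N) (σ := 1 + α)
    (by linarith : (0:ℝ) < 1 + α) (summable_norm_vmIn_div_rpow hgb P (by linarith))
    (show (1:ℝ) < 1 + α by linarith) (fun y hy => norm_psum_vmIn_le_six hgb P hy) (ν := ν) (by linarith)
  simp only [ofReal_one_add] at hP
  have hV := intervalMeanSquare_le_of_vanish hC0 hC (b := vmIn P g N) (fun n => norm_vmIn_le hgb P n) hQ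
    (fun n hn hQn => vmIn_prime_eq_zero hPp hPQ hn hQn) hν hν2 hα
  have heq : ∫ y : ℝ, ‖LSeries (vmIn P g N) (1 + α + y * I)‖ ^ 2 * wI ν α y =
      2 * π * ∫ u : ℝ, ‖psum (vmIn P g N) (ν * Real.exp u) - psum (vmIn P g N) (Real.exp u)‖ ^ 2 *
        Real.exp (-(2 * (1 + α) * u)) := by
    rw [hP]
    have hπ : (2 : ℝ) * π ≠ 0 := by positivity
    rw [← mul_assoc, show (2 : ℝ) * π * (1 / (2 * π)) = 1 by field_simp, one_mul]
    rfl
  rw [heq]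
  exact mul_le_mul_of_nonneg_left hV (by positivity)

/-- `y ↦ |L_b(1+α+iy)|² w_ν(α,y)` is integrable and `≤ 25 |L_b|²/|s|²` whenever `∑ |b_n| n^{-1-α} < ∞`
(used for `b = D_a`, `P_∁`, `P_i`). [folklore] -/
theorem integrable_normSq_mul_wI {b : ℕ → ℂ} {α : ℝ} (hα : 0 < α) (hα1 : α ≤ 1)
    (hsum : Summable fun n : ℕ => ‖b n‖ / (n : ℝ) ^ (1 + α)) {ν : ℝ} (hν : 0 < ν) (hν2 : ν ≤ 2) :
    Integrable (fun y : ℝ => ‖LSeries b (1 + α + y * I)‖ ^ 2 * wI ν α y) ∧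
      ∀ y : ℝ, ‖LSeries b (1 + α + y * I)‖ ^ 2 * wI ν α y ≤
        25 * (‖LSeries b (1 + α + y * I)‖ ^ 2 / ‖(1 : ℂ) + α + y * I‖ ^ 2) := by
  have hle : ∀ y : ℝ, ‖LSeries b (1 + α + y * I)‖ ^ 2 * wI ν α y ≤
      25 * (‖LSeries b (1 + α + y * I)‖ ^ 2 / ‖(1 : ℂ) + α + y * I‖ ^ 2) := by
    intro y
    calc ‖LSeries b (1 + α + y * I)‖ ^ 2 * wI ν α y
        ≤ ‖LSeries b (1 + α + y * I)‖ ^ 2 * (25 / ‖(1 : ℂ) + α + y * I‖ ^ 2) :=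
          mul_le_mul_of_nonneg_left (wI_le hν hν2 hα.le hα1 y) (by positivity)
      _ = 25 * (‖LSeries b (1 + α + y * I)‖ ^ 2 / ‖(1 : ℂ) + α + y * I‖ ^ 2) := by ring
  refine ⟨?_, hle⟩
  have hint := integrable_norm_LSeries_sq_div (a := b) (σ := 1 + α) (by linarith) hsum
  simp only [ofReal_one_add] at hint
  have hcont : Continuous fun y : ℝ => ‖LSeries b (1 + α + y * I)‖ ^ 2 * wI ν α y := by
    have hc := continuous_LSeries_line (a := b) (σ := 1 + α) hsum
    simp only [ofReal_one_add] at hc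
    exact (hc.norm.pow 2).mul (continuous_wI hν hα.le)
  refine (hint.const_mul 25).mono' hcont.aestronglyMeasurable (Filter.Eventually.of_forall fun y => ?_)
  rw [Real.norm_of_nonneg (mul_nonneg (by positivity) (wI_nonneg ν α y))]
  exact hle y

/-- **Granville–Soundararajan's Lemma 3.2 for the restricted function over multiplicative windows**
(the mean square input of the short-interval Halász theorem).  Let `a = g̃ 1_𝒮` for a block system of primes
`≤ Q` (`Q ≥ e²`), `0 < α ≤ 1`, `T₀ ≥ 1`, `1 < ν ≤ 2`, `C` a constant of the prime number theorem
`|θ(x) - x| ≤ Cx/(log x)^6`; suppose `‖𝒢_a(1+α+iy)‖ ≤ B` for `|y| ≤ T₀` and `‖𝒢_{a_i}(1+α+iy)‖ ≤ B_c`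
for all `y`, `i`.  Then, with `A(y) = ∑_{n ≤ y} a(n) log n` and `u₁ = uPNT C ν`,
`∫_ℝ |A(νe^u) - A(e^u)|² e^{-2(1+α)u} du ≤ 2B²(4(ν-1)²/α + 16u₁ + 256) + 2B_c²|𝓙|²(8(ν-1)² log Q + 16u₁ + 256)
  + (25/π)(240/T₀ + (1920 + 520e^{10}/α³)/T₀²)`.
Compared with `meanSquare_mulLog_restr_le` (the tree's bound `36B²/α + 2B_c²|𝓙|²(36 log Q + 25) + …` for `A`
itself), the `1/α`- and `log Q`-terms have gained the factor `(ν - 1)²`: by Mellin–Plancherel with the window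
multiplier `(ν^s - 1)/s` (`MellinPlancherel.integral_norm_sq_psum_interval_exp`) the `Λ`-polynomials enter
through the increments of their summatory functions over `(y, νy]`, which the prime number theorem bounds by
`2(ν-1)y` beyond `e^{u₁}`. [cite: GranvilleSoundararajan2003, Lemma 3.2] -/
theorem meanSquare_mulLog_restr_interval_le [DecidableEq ι] (h : IsBlockSystem 𝓙 blk N)
    (hg : ∀ m n, g (m * n) = g m * g n) (hg1 : g 1 = 1) (hgb : ∀ n, ‖g n‖ ≤ 1)
    {C : ℝ} (hC0 : 0 ≤ C) (hC : ∀ x : ℝ, 2 ≤ x → |θ x - x| ≤ C * x / Real.log x ^ (6 : ℝ))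
    {α : ℝ} (hα : 0 < α) (hα1 : α ≤ 1) {T₀ : ℝ} (hT₀ : 1 ≤ T₀) {Q : ℝ} (hQ : Real.exp 2 ≤ Q)
    (hblkQ : ∀ i ∈ 𝓙, ∀ p ∈ blk i, (p : ℝ) ≤ Q) {ν : ℝ} (hν : 1 < ν) (hν2 : ν ≤ 2) {B Bc : ℝ}
    (hB : ∀ y : ℝ, |y| ≤ T₀ → ‖LSeries (restr 𝓙 blk g N) (1 + α + y * I)‖ ≤ B)
    (hBc : ∀ i ∈ 𝓙, ∀ y : ℝ, ‖LSeries (restr (𝓙.erase i) blk g N) (1 + α + y * I)‖ ≤ Bc) :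
    ∫ u : ℝ, ‖psum (mulLog (restr 𝓙 blk g N) N) (ν * Real.exp u) -
        psum (mulLog (restr 𝓙 blk g N) N) (Real.exp u)‖ ^ 2 * Real.exp (-(2 * (1 + α) * u)) ≤
      2 * B ^ 2 * (4 * (ν - 1) ^ 2 / α + (16 * uPNT C ν + 256)) +
        2 * Bc ^ 2 * (𝓙.card : ℝ) ^ 2 * (8 * (ν - 1) ^ 2 * Real.log Q + (16 * uPNT C ν + 256)) +
        25 / π * (240 / T₀ + (1920 + 520 * Real.exp 10 / α ^ 3) / T₀ ^ 2) := by
  have hab := norm_restr_le_one (𝓙 := 𝓙) (blk := blk) (N := N) hgb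
  set a := restr 𝓙 blk g N with ha_def
  have hν0 : 0 < ν := by linarith
  have hQ1 : 1 ≤ Q := le_trans (by have := Real.add_one_le_exp (2:ℝ); linarith) hQ
  set G : ℝ := 16 * uPNT C ν + 256 with hG
  have hG0 : 0 ≤ G := by have := one_le_uPNT hC0 hν; rw [hG]; linarith
  set Tl : ℝ := 240 / T₀ + (1920 + 520 * Real.exp 10 / α ^ 3) / T₀ ^ 2 with hTl
  have hTl0 : 0 ≤ Tl := by
    have : 0 < T₀ := by linarith
    positivity
  -- Plancherel for `D_a` with the window multiplier
  have hP := MellinPlancherel.integral_norm_sq_psum_interval_exp (a := mulLog a N) (σ := 1 + α)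
    (by linarith : (0:ℝ) < 1 + α) (summable_norm_mulLog_div_rpow hab (by linarith))
    (show 1 + α / 2 < 1 + α by linarith) (fun y hy => norm_psum_mulLog_le hab hα y hy) (ν := ν) hν0
  simp only [ofReal_one_add] at hP
  rw [hP]
  -- the integrand `F = |D_a|² w` and its majorant `25 |D_a|²/|s|²`
  set F : ℝ → ℝ := fun y => ‖LSeries (mulLog a N) (1 + α + y * I)‖ ^ 2 * wI ν α y with hF
  set F₀ : ℝ → ℝ := fun y => ‖LSeries (mulLog a N) (1 + α + y * I)‖ ^ 2 / ‖(1 : ℂ) + α + y * I‖ ^ 2 with hF₀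
  obtain ⟨hFint, hFle⟩ := integrable_normSq_mul_wI (b := mulLog a N) hα hα1
    (summable_norm_mulLog_div_rpow hab (by linarith)) hν0 hν2
  have hF₀int : Integrable F₀ := integrable_normSq_mulLog_div (N := N) hab hα
  have hFF : ∫ y : ℝ, ‖LSeries (mulLog a N) (1 + α + y * I)‖ ^ 2 *
      (‖(ν : ℂ) ^ ((1 : ℂ) + α + y * I) - 1‖ ^ 2 / ‖(1 : ℂ) + α + y * I‖ ^ 2) = ∫ y, F y := rfl
  rw [hFF]
  -- the `P`-integrals
  set IP : ℝ := ∫ y : ℝ, ‖LSeries (mulVM (sieveOut (𝓙.biUnion blk) g) N) (1 + α + y * I)‖ ^ 2 * wI ν α y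
    with hIP
  have hIP_le : IP ≤ 2 * π * (4 * (ν - 1) ^ 2 / α + G) := by
    have := integral_normSq_mulVM_wI_le (N := N) hC0 hC (norm_sieveOut_le hgb (𝓙.biUnion blk)) hν hν2 hα
    calc IP ≤ 2 * π * (4 * (ν - 1) ^ 2 / α + 16 * uPNT C ν + 256) := this
      _ = 2 * π * (4 * (ν - 1) ^ 2 / α + G) := by rw [hG]; ring
  have hIPi : ∀ i ∈ 𝓙, ∫ y : ℝ, ‖LSeries (vmIn (blk i) g N) (1 + α + y * I)‖ ^ 2 * wI ν α y ≤
      2 * π * (8 * (ν - 1) ^ 2 * Real.log Q + G) := by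
    intro i hi
    have hPp : ∀ p ∈ blk i, p.Prime := fun p hp => h.prime_of_mem hi hp
    have := integral_normSq_vmIn_wI_le (N := N) hC0 hC hgb hPp hQ1 (hblkQ i hi) hν hν2 hα
    calc _ ≤ 2 * π * (8 * (ν - 1) ^ 2 * Real.log Q + 16 * uPNT C ν + 256) := this
      _ = 2 * π * (8 * (ν - 1) ^ 2 * Real.log Q + G) := by rw [hG]; ring
  have hsumIPi : ∑ i ∈ 𝓙, ∫ y : ℝ, ‖LSeries (vmIn (blk i) g N) (1 + α + y * I)‖ ^ 2 * wI ν α y ≤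
      𝓙.card * (2 * π * (8 * (ν - 1) ^ 2 * Real.log Q + G)) := by
    calc ∑ i ∈ 𝓙, ∫ y : ℝ, ‖LSeries (vmIn (blk i) g N) (1 + α + y * I)‖ ^ 2 * wI ν α y
        ≤ ∑ i ∈ 𝓙, 2 * π * (8 * (ν - 1) ^ 2 * Real.log Q + G) := Finset.sum_le_sum hIPi
      _ = 𝓙.card * (2 * π * (8 * (ν - 1) ^ 2 * Real.log Q + G)) := by rw [Finset.sum_const, nsmul_eq_mul]
  -- the window
  have hwin : ∫ y in Set.Icc (-T₀) T₀, F y ≤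
      2 * B ^ 2 * IP + 2 * Bc ^ 2 * 𝓙.card * (𝓙.card * (2 * π * (8 * (ν - 1) ^ 2 * Real.log Q + G))) := by
    set R₀ : ℝ → ℝ := fun y => ‖LSeries (mulVM (sieveOut (𝓙.biUnion blk) g) N) (1 + α + y * I)‖ ^ 2 *
      wI ν α y with hR₀
    set Ri : ι → ℝ → ℝ := fun i y => ‖LSeries (vmIn (blk i) g N) (1 + α + y * I)‖ ^ 2 * wI ν α y with hRi
    have hR₀int : Integrable R₀ :=
      (integrable_normSq_mul_wI hα hα1 (summable_norm_mulVM_div_rpow (N := N) (norm_sieveOut_le hgb _) (by linarith))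
        hν0 hν2).1
    have hRiint : ∀ i ∈ 𝓙, Integrable (Ri i) := fun i _ =>
      (integrable_normSq_mul_wI hα hα1 (summable_norm_vmIn_div_rpow (N := N) hgb _ (by linarith)) hν0 hν2).1
    set R : ℝ → ℝ := fun y => 2 * B ^ 2 * R₀ y + 2 * Bc ^ 2 * 𝓙.card * ∑ i ∈ 𝓙, Ri i y with hR
    have hRint : Integrable R := by
      refine Integrable.add (hR₀int.const_mul _) ?_
      exact (integrable_finsetSum 𝓙 hRiint).const_mul _
    have hR0 : 0 ≤ᵐ[volume] R := Filter.Eventually.of_forall fun y => by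
      simp only [hR, hR₀, hRi]
      have hw := wI_nonneg ν α y
      have : 0 ≤ ∑ i ∈ 𝓙, ‖LSeries (vmIn (blk i) g N) (1 + ↑α + ↑y * I)‖ ^ 2 * wI ν α y :=
        Finset.sum_nonneg fun i _ => by positivity
      positivity
    calc ∫ y in Set.Icc (-T₀) T₀, F y ≤ ∫ y in Set.Icc (-T₀) T₀, R y := by
          refine setIntegral_mono_on hFint.integrableOn hRint.integrableOn measurableSet_Icc fun y hy => ?_
          have hyT : |y| ≤ T₀ := abs_le.2 ⟨by linarith [hy.1], hy.2⟩
          have hsre : 1 < ((1 : ℂ) + α + y * I).re := by simp; linarith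
          have hpt := norm_mulLog_restr_sq_le h hg hg1 hgb hsre (hB y hyT) (fun i hi => hBc i hi y)
          have hw := wI_nonneg ν α y
          simp only [hF, hR, hR₀, hRi]
          calc ‖LSeries (mulLog a N) (1 + α + y * I)‖ ^ 2 * wI ν α y
              ≤ (2 * B ^ 2 * ‖LSeries (mulVM (sieveOut (𝓙.biUnion blk) g) N) (1 + α + y * I)‖ ^ 2 +
                  2 * Bc ^ 2 * 𝓙.card * ∑ i ∈ 𝓙, ‖LSeries (vmIn (blk i) g N) (1 + α + y * I)‖ ^ 2) *
                  wI ν α y := mul_le_mul_of_nonneg_right hpt hw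
            _ = _ := by
                rw [add_mul]
                congr 1
                · ring
                · rw [Finset.mul_sum, Finset.mul_sum, Finset.sum_mul]
                  exact Finset.sum_congr rfl fun i _ => by ring
      _ ≤ ∫ y, R y := setIntegral_le_integral hRint hR0
      _ = 2 * B ^ 2 * IP + 2 * Bc ^ 2 * 𝓙.card * ∑ i ∈ 𝓙, ∫ y, Ri i y := by
          simp only [hR]
          rw [integral_add (hR₀int.const_mul _) ((integrable_finsetSum 𝓙 hRiint).const_mul _),
            integral_const_mul, integral_const_mul, integral_finsetSum 𝓙 hRiint]
      _ ≤ 2 * B ^ 2 * IP + 2 * Bc ^ 2 * 𝓙.card * (𝓙.card * (2 * π * (8 * (ν - 1) ^ 2 * Real.log Q + G))) := by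
          have hBc2 : 0 ≤ 2 * Bc ^ 2 * (𝓙.card : ℝ) := by positivity
          exact add_le_add le_rfl (mul_le_mul_of_nonneg_left hsumIPi hBc2)
  -- the tails
  have htails : ∫ y in (Set.Icc (-T₀) T₀)ᶜ, F y ≤ 25 * Tl + 25 * Tl := by
    have ht1 := setIntegral_Iio_dyadic_tail_le (N := N) hab hα hα1 hT₀
    have ht2 := setIntegral_Ioi_dyadic_tail_le (N := N) hab hα hα1 hT₀
    have hsub : (Set.Icc (-T₀) T₀)ᶜ ⊆ Set.Iio (-T₀) ∪ Set.Ioi T₀ := by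
      intro y hy
      simp only [Set.mem_compl_iff, Set.mem_Icc, not_and_or, not_le] at hy
      rcases hy with h' | h'
      · exact Or.inl h'
      · exact Or.inr h'
    have hF0 : ∀ y, 0 ≤ F y := fun y => by simp only [hF]; exact mul_nonneg (by positivity) (wI_nonneg ν α y)
    have hmono : ∀ s : Set ℝ, MeasurableSet s → ∫ y in s, F y ≤ 25 * ∫ y in s, F₀ y := by
      intro s hs
      rw [← integral_const_mul]
      exact setIntegral_mono_on hFint.integrableOn (hF₀int.const_mul 25).integrableOn hs fun y _ => hFle y
    calc ∫ y in (Set.Icc (-T₀) T₀)ᶜ, F y ≤ ∫ y in Set.Iio (-T₀) ∪ Set.Ioi T₀, F y :=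
          setIntegral_mono_set hFint.integrableOn (Filter.Eventually.of_forall hF0) hsub.eventuallyLE
      _ = (∫ y in Set.Iio (-T₀), F y) + ∫ y in Set.Ioi T₀, F y := by
          refine setIntegral_union ?_ measurableSet_Ioi hFint.integrableOn hFint.integrableOn
          exact Set.disjoint_left.2 fun y hy hy' => by
            simp only [Set.mem_Iio] at hy; simp only [Set.mem_Ioi] at hy'
            linarith
      _ ≤ 25 * (∫ y in Set.Iio (-T₀), F₀ y) + 25 * ∫ y in Set.Ioi T₀, F₀ y :=
          add_le_add (hmono _ measurableSet_Iio) (hmono _ measurableSet_Ioi)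
      _ ≤ 25 * Tl + 25 * Tl := by
          simp only [hF₀, hTl] at ht1 ht2 ⊢
          have := add_le_add (mul_le_mul_of_nonneg_left ht1 (by norm_num : (0:ℝ) ≤ 25))
            (mul_le_mul_of_nonneg_left ht2 (by norm_num : (0:ℝ) ≤ 25))
          exact this
  -- assemble
  have hsplit : ∫ y, F y = (∫ y in Set.Icc (-T₀) T₀, F y) + ∫ y in (Set.Icc (-T₀) T₀)ᶜ, F y :=
    (integral_add_compl (measurableSet_Icc (a := -T₀) (b := T₀)) hFint).symm
  have hπ0 : 0 < π := Real.pi_pos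
  have h2π : 0 < 1 / (2 * π) := by positivity
  calc 1 / (2 * π) * ∫ y, F y
      = 1 / (2 * π) * ((∫ y in Set.Icc (-T₀) T₀, F y) + ∫ y in (Set.Icc (-T₀) T₀)ᶜ, F y) := by rw [hsplit]
    _ ≤ 1 / (2 * π) * ((2 * B ^ 2 * IP +
          2 * Bc ^ 2 * 𝓙.card * (𝓙.card * (2 * π * (8 * (ν - 1) ^ 2 * Real.log Q + G)))) + (25 * Tl + 25 * Tl)) := by
        gcongr
    _ ≤ 1 / (2 * π) * ((2 * B ^ 2 * (2 * π * (4 * (ν - 1) ^ 2 / α + G)) +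
          2 * Bc ^ 2 * 𝓙.card * (𝓙.card * (2 * π * (8 * (ν - 1) ^ 2 * Real.log Q + G)))) + (25 * Tl + 25 * Tl)) := by
        gcongr
    _ = 2 * B ^ 2 * (4 * (ν - 1) ^ 2 / α + G) + 2 * Bc ^ 2 * (𝓙.card : ℝ) ^ 2 * (8 * (ν - 1) ^ 2 * Real.log Q + G) +
          25 / π * Tl := by
        field_simp
        ring

end Restricted

end Halasz

end Literature.NumberTheory.LFunctions
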